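import Summits.BirchSwinnertonDyer.BirchSwinnertonDyer.Theorems.AdditiveBranchIMCGordTwoRankOneHeegnerKolyvaginNecessity
import Summits.BirchSwinnertonDyer.BirchSwinnertonDyer.Theorems.AdditiveBranchIMCGordTwoRankOneHeegnerKolyvaginStepL
import Literature.NumberTheory.EllipticCurves.BSDSelmerPConverseSerreProofs
import HarnessLib

/-!
# Route `AdditiveBranchIMC` (rung K1), crux `GordTwoRankOne` (item 19358): the Heegner–Kolyvagin road,
# Part 10 — STEP L′ ⟺ LOWER(E,p), STEP U′ ⟺ UPPER(E,p), adjusted index identity ⟺ `BSD(E,p)`,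
# given the rank-zero twist's `p`-part (cell `bsd-addord`, lane `bsd-addord-k1-c3x`, gen 2; `--supports` only)

HONEST FRAMING. THEOREMS ONLY: no definition, no new named fact, no `sorry`; nothing is booked; the crux
stays OPEN at class level; «BSD is not proved by any of this». Continuation of Part 9
(`…HeegnerKolyvaginNecessity`): there the halves of `BSD(E,p)` and of the twist's `p`-part were shown to
GIVE the road's typed input STEP L′ (and its reverse STEP U′, and the adjusted index identity). Here the two
directions are assembled into EQUIVALENCES at a Heegner datum (any reduction type at `p`, any odd
`p ∤ #𝓞_K^×`, no image hypothesis, Manin term kept), given the rank-ZERO twist's exact `p`-part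
`Typed.MissingPPartAt Wd p` — which on the tower-surjective rows of cell (G-ord, `e = 2`) is Kato 2004
Thm 14.5 (3) [UPPER, PUBLISHED] ∧ crux `GordTwoRankZeroOffCaseOne` (item 19357)'s conclusion at `(Wd, p)`
[LOWER, OPEN]:

* `missingLowerBoundAt_iff_adjustedIndexBound_of_twistExact` — STEP L′ ⟺ `Typed.MissingLowerBoundAt W p`
  (⇐ of the iff is Part 8's `missingLowerBoundAt_of_adjustedIndexBound`);
* `missingUpperBoundAt_iff_adjustedIndexUpperBound_of_twistExact` — STEP U′ ⟺ `Typed.MissingUpperBoundAt W p`;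
* `missingPPartAt_iff_adjustedIndexIdentity_of_twistExact`, `bsdp_iff_adjustedIndexIdentity_of_twistExact` —
  `2·ord_p[E(K):ℤP] = ord_p #Ш(E/K) + ord_p ∏c(E) + ord_p ∏c(Wd) + 2·ord_p c(Dt)` ⟺ `Typed.MissingPPartAt W p`
  ⟺ `BSDp W p` — the additive-prime, arbitrary-datum analogue of x11b's `IndexIdentityAt ⟹ BSDp`.

* §21 `cellGordTwo_missingLowerBoundAt_rankOne_of_surj_five_of_adjustedIndexBound`,
  `gordTwoRankOne_of_adjustedIndexBound_of_rest'` — Part 8's class-level theorem and crux BY NAME re-keyed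
  on the census bit `surj(p)` at `p ≥ 5` (Serre's lifting lemma, tree theorem
  `serre_hasSurjectiveModNGaloisRep_pow_holds`: `ρ̄_{E,p}` onto ⟹ `ρ̄_{E,p^n}` onto for all `n` when
  `p ≥ 5`), so the displayed complement is exactly «non-CM ∧ ¬surj(p)» at `p ≥ 5` (X3♯ reducible rows and
  the O8 small-image rows) and «non-CM ∧ ¬towerSurj(3)» at `p = 3`.

So on lane B's road the crux 19358 at a tower-surjective pair and 19357 at its Friedberg–Hoffstein twist are
JOINTLY equivalent, modulo PUBLISHED facts, to STEP L′ ∧ 19357-at-the-twist: the road neither loses nor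
smuggles anything. PUBLISHED binders throughout: `hGZ`, `hKo`, `hGZK`, `hmod`.

References: [JetchevSkinnerWan2017] §7.4.1–§7.4.2 (pp. 29–31); [GrossZagier1986] V.§2, Conj. (V.2.2);
[Gross1991] (2.2); [Miller2011LMS] §1, Def. 1.1; [Kato2004Asterisque] Thm. 14.5 (3).
-/

set_option autoImplicit false
set_option linter.dupNamespace false
noncomputable section

open scoped Classical NumberField
open WeierstrassCurve NumberField IsDedekindDomain
  Literature.NumberTheory.EllipticCurves Literature.NumberTheory.EllipticCurves.ModularForms
  Literature.NumberTheory.EllipticCurves.Rank1Residual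
  Literature.NumberTheory.EllipticCurves.Rank1Residual.Typed
  Summit.BirchSwinnertonDyer.Rank1Residual
  Summit.BirchSwinnertonDyer.Rank1Residual.Additive
  Summit.BirchSwinnertonDyer.Rank1Residual.X11b
  Summit.BirchSwinnertonDyer.Rank1Residual.GaloisImage
  Literature.NumberTheory.Automorphic

namespace Summit.BirchSwinnertonDyer.BirchSwinnertonDyer.Theorems.AdditiveBranchIMCGordTwoRankOne.HeegnerKolyvagin

/-! ### §19 Equivalence given the rank-zero twist's `p`-part -/

section Datum

variable (W : WeierstrassCurve ℚ) [W.IsElliptic] [W.IsGloballyMinimal] (p : ℕ) [Fact p.Prime]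
  (N : ℕ) [NeZero N] (K : Type) [Field K] [NumberField K]
  (Dt : ModularParametrizationData W N) (H : HeegnerDatum N (NumberField.discr K)) (ι : K →+* ℂ)
  (P : (W.baseChange K).toAffine.Point)


/-- **STEP L′ ⟺ the LOWER half of `BSD(E,p)`, given the twist's exact `p`-part.** Same data and PUBLISHED
binders; with `Typed.MissingPPartAt Wd p` (on the tower-surjective rows at an additive potentially good
`p`: Kato 2004 Thm 14.5 (3) ∧ crux 19357's conclusion at `(Wd, p)`), the road's input STEP L′ at the datum
holds IFF `Typed.MissingLowerBoundAt W p`. (⇒ is Part 8's `missingLowerBoundAt_of_adjustedIndexBound` with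
`htw` from `twist_exact_of_missingPPartAt`; ⇐ is `adjustedIndexBound_of_missingLowerBoundAt_of_twistLower`.)
[cite: JetchevSkinnerWan2017, §7.4.1 (pp. 29–31)] [cite: Miller2011LMS, Def. 1.1] -/
theorem missingLowerBoundAt_iff_adjustedIndexBound_of_twistExact
    (hGZ : gross_zagier N W K) (hKo : kolyvagin N W K)
    (hGZK : rank_eq_analyticRank_of_analyticRank_le_one) (hmod : hasEntireLFunction_rat)
    (hK : IsImaginaryQuadratic K) (hHN : SatisfiesHeegnerHypothesis N K)
    (hP : WeierstrassCurve.Affine.Point.map ι.toRatAlgHom P = heegnerPointComplex Dt H)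
    (hp2 : p ≠ 2) (hμ : ¬ p ∣ Units.torsionOrder K)
    (hr : W.analyticRank = 1)
    (hLt : (W.quadraticTwist (NumberField.discr K : ℚ)).entireLFunction 1 ≠ 0)
    (Wd : WeierstrassCurve ℚ) [Wd.IsElliptic] [Wd.IsGloballyMinimal] (Cd : VariableChange ℚ)
    (hWd : Cd • W.quadraticTwist (NumberField.discr K : ℚ) = Wd)
    (hu : padicValRat p (Cd.u : ℚ) = 0)
    (htw : Typed.MissingPPartAt Wd p) :
    Typed.MissingLowerBoundAt W p ↔
      (2 * padicValNat p (AddSubgroup.zmultiples P).index : ℤ) ≤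
        padicValNat p (W.baseChange K).shaOrder + padicValNat p W.tamagawaProduct +
          padicValNat p Wd.tamagawaProduct + 2 * padicValRat p (Dt.c : ℚ) := by
  obtain ⟨hld, hud⟩ := lower_and_upper_of_missingPPartAt Wd p htw
  refine ⟨fun hlow ↦ adjustedIndexBound_of_missingLowerBoundAt_of_twistLower W p N K Dt H ι P hGZ hKo hGZK
    hmod hK hHN hP hp2 hμ hr hLt Wd Cd hWd hu hlow hld, fun hL' ↦ ?_⟩
  have hLd1 : Wd.entireLFunction 1 ≠ 0 := twistModel_entireLFunction_one_ne_zero W K hLt Wd Cd hWd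
  exact missingLowerBoundAt_of_adjustedIndexBound W p N K Dt H ι P hGZ hKo hGZK hmod hK hHN hP hp2 hμ hr hLt
    Wd Cd hWd hu (twist_le_half_of_missingUpperBoundAt hGZK hmod Wd p hLd1 hud) (fun _ ↦ hL')

/-- **STEP U′ ⟺ the UPPER half of `BSD(E,p)`, given the twist's exact `p`-part.** (⇒: Part 4's identity,
`v(q) = 2v(I) − v(q_d) − v(c_E) − 2v(t_d) − 2v(c) ≥ v(Ш_K) + v(c_d) − v(q_d) − 2v(t_d) = v(Ш_E)` by the
twist's exactness; ⇐: `adjustedIndexUpperBound_of_missingUpperBoundAt_of_twistUpper`.) On the road the UPPER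
half itself is Part 6 (Kolyvagin 1990 + the twist's lower half, `p ≥ 5`, `p ∤ ∏c(E)`); this is the exact
bookkeeping form with no side condition. [cite: JetchevSkinnerWan2017, §7.4.2 (p. 31)] [cite: Miller2011LMS, Def. 1.1] -/
theorem missingUpperBoundAt_iff_adjustedIndexUpperBound_of_twistExact
    (hGZ : gross_zagier N W K) (hKo : kolyvagin N W K)
    (hGZK : rank_eq_analyticRank_of_analyticRank_le_one) (hmod : hasEntireLFunction_rat)
    (hK : IsImaginaryQuadratic K) (hHN : SatisfiesHeegnerHypothesis N K)
    (hP : WeierstrassCurve.Affine.Point.map ι.toRatAlgHom P = heegnerPointComplex Dt H)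
    (hp2 : p ≠ 2) (hμ : ¬ p ∣ Units.torsionOrder K)
    (hr : W.analyticRank = 1)
    (hLt : (W.quadraticTwist (NumberField.discr K : ℚ)).entireLFunction 1 ≠ 0)
    (Wd : WeierstrassCurve ℚ) [Wd.IsElliptic] [Wd.IsGloballyMinimal] (Cd : VariableChange ℚ)
    (hWd : Cd • W.quadraticTwist (NumberField.discr K : ℚ) = Wd)
    (hu : padicValRat p (Cd.u : ℚ) = 0)
    (htw : Typed.MissingPPartAt Wd p) :
    Typed.MissingUpperBoundAt W p ↔
      (padicValNat p (W.baseChange K).shaOrder : ℤ) + padicValNat p W.tamagawaProduct +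
          padicValNat p Wd.tamagawaProduct + 2 * padicValRat p (Dt.c : ℚ) ≤
        2 * padicValNat p (AddSubgroup.zmultiples P).index := by
  obtain ⟨hld, hud⟩ := lower_and_upper_of_missingPPartAt Wd p htw
  refine ⟨fun hup ↦ adjustedIndexUpperBound_of_missingUpperBoundAt_of_twistUpper W p N K Dt H ι P hGZ hKo
    hGZK hmod hK hHN hP hp2 hμ hr hLt Wd Cd hWd hu hup hud, fun hU' ↦ ?_⟩
  have hLd1 : Wd.entireLFunction 1 ≠ 0 := twistModel_entireLFunction_one_ne_zero W K hLt Wd Cd hWd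
  obtain ⟨qd, hqd, hvqd⟩ := twist_exact_of_missingPPartAt hGZK hmod Wd p hLd1 htw
  obtain ⟨-, -, hsha, q, hq, hval⟩ := exists_shaAn_padicVal_eq_of_heegner_maninKept W p N K Dt H ι P
    hGZ hKo hGZK hmod hK hHN hP hp2 hμ hr hLt Wd Cd hWd hu qd hqd
  refine ⟨q, hq, ?_⟩
  have e2 : (padicValNat p (W.baseChange K).shaOrder : ℤ) =
      padicValNat p W.shaOrder + padicValNat p Wd.shaOrder := by exact_mod_cast hsha
  linarith

/-- **The adjusted index IDENTITY ⟺ the whole missing `p`-part `Typed.MissingPPartAt W p`, given the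
twist's exact `p`-part** — the additive-prime analogue (arbitrary datum, Manin term kept, no image or
Tamagawa hypothesis) of x11b's passage `IndexIdentityAt ⟹ BSDp`. With Gross–Zagier–Kolyvagin (`hGZK`)
`Typed.MissingPPartAt W p ⟺ BSDp W p` (`Typed.bsdp_of_missingPPartAt` / `missingPPartAt_of_bsdp`).
[cite: GrossZagier1986, V.§2 and Conj. (V.2.2)] [cite: Gross1991, (2.2)] [cite: Miller2011LMS, Def. 1.1] -/
theorem missingPPartAt_iff_adjustedIndexIdentity_of_twistExact
    (hGZ : gross_zagier N W K) (hKo : kolyvagin N W K)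
    (hGZK : rank_eq_analyticRank_of_analyticRank_le_one) (hmod : hasEntireLFunction_rat)
    (hK : IsImaginaryQuadratic K) (hHN : SatisfiesHeegnerHypothesis N K)
    (hP : WeierstrassCurve.Affine.Point.map ι.toRatAlgHom P = heegnerPointComplex Dt H)
    (hp2 : p ≠ 2) (hμ : ¬ p ∣ Units.torsionOrder K)
    (hr : W.analyticRank = 1)
    (hLt : (W.quadraticTwist (NumberField.discr K : ℚ)).entireLFunction 1 ≠ 0)
    (Wd : WeierstrassCurve ℚ) [Wd.IsElliptic] [Wd.IsGloballyMinimal] (Cd : VariableChange ℚ)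
    (hWd : Cd • W.quadraticTwist (NumberField.discr K : ℚ) = Wd)
    (hu : padicValRat p (Cd.u : ℚ) = 0)
    (htw : Typed.MissingPPartAt Wd p) :
    Typed.MissingPPartAt W p ↔
      (2 * padicValNat p (AddSubgroup.zmultiples P).index : ℤ) =
        padicValNat p (W.baseChange K).shaOrder + padicValNat p W.tamagawaProduct +
          padicValNat p Wd.tamagawaProduct + 2 * padicValRat p (Dt.c : ℚ) := by
  refine ⟨fun hpp ↦ adjustedIndexIdentity_of_missingPPartAt_of_twist W p N K Dt H ι P hGZ hKo hGZK hmod hK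
    hHN hP hp2 hμ hr hLt Wd Cd hWd hu hpp htw, fun hI ↦ ?_⟩
  exact missingPPartAt_of_lower_of_upper W p
    ((missingLowerBoundAt_iff_adjustedIndexBound_of_twistExact W p N K Dt H ι P hGZ hKo hGZK hmod hK hHN hP
      hp2 hμ hr hLt Wd Cd hWd hu htw).2 hI.le)
    ((missingUpperBoundAt_iff_adjustedIndexUpperBound_of_twistExact W p N K Dt H ι P hGZ hKo hGZK hmod hK
      hHN hP hp2 hμ hr hLt Wd Cd hWd hu htw).2 hI.ge)

/-- **`BSD(E,p)` ⟺ the adjusted index identity, given the twist's exact `p`-part** (Miller's currency; the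
finiteness of `Ш(E)` needed for `BSDp ⟹ MissingPPartAt` holds at the datum by Gross–Zagier–Kolyvagin).
[cite: GrossZagier1986, V.§2 and Conj. (V.2.2)] [cite: Miller2011LMS, §1 and Def. 1.1] -/
theorem bsdp_iff_adjustedIndexIdentity_of_twistExact
    (hGZ : gross_zagier N W K) (hKo : kolyvagin N W K)
    (hGZK : rank_eq_analyticRank_of_analyticRank_le_one) (hmod : hasEntireLFunction_rat)
    (hK : IsImaginaryQuadratic K) (hHN : SatisfiesHeegnerHypothesis N K)
    (hP : WeierstrassCurve.Affine.Point.map ι.toRatAlgHom P = heegnerPointComplex Dt H)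
    (hp2 : p ≠ 2) (hμ : ¬ p ∣ Units.torsionOrder K)
    (hr : W.analyticRank = 1)
    (hLt : (W.quadraticTwist (NumberField.discr K : ℚ)).entireLFunction 1 ≠ 0)
    (Wd : WeierstrassCurve ℚ) [Wd.IsElliptic] [Wd.IsGloballyMinimal] (Cd : VariableChange ℚ)
    (hWd : Cd • W.quadraticTwist (NumberField.discr K : ℚ) = Wd)
    (hu : padicValRat p (Cd.u : ℚ) = 0)
    (htw : Typed.MissingPPartAt Wd p) :
    BSDp W p ↔
      (2 * padicValNat p (AddSubgroup.zmultiples P).index : ℤ) =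
        padicValNat p (W.baseChange K).shaOrder + padicValNat p W.tamagawaProduct +
          padicValNat p Wd.tamagawaProduct + 2 * padicValRat p (Dt.c : ℚ) := by
  haveI : Finite W.sha := (hGZK W (le_of_eq hr)).2
  rw [← missingPPartAt_iff_adjustedIndexIdentity_of_twistExact W p N K Dt H ι P hGZ hKo hGZK hmod hK hHN hP
    hp2 hμ hr hLt Wd Cd hWd hu htw]
  exact ⟨fun h ↦ missingPPartAt_of_bsdp W p h, fun h ↦ bsdp_of_missingPPartAt W p hGZK (le_of_eq hr) h⟩

end Datum

/-! ### §21 The class-level theorem and the crux BY NAME keyed on the census bit `surj(p)` at `p ≥ 5` -/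

/-- **Part 8's class-level theorem with `surj(p)` in place of tower-surjectivity at `p ≥ 5`.** For
`p ≥ 5`, `ρ̄_{E,p}` onto already gives `ρ̄_{E,p^n}` onto for every `n` (Serre, *Abelian ℓ-adic
representations* IV-23 Lemma 3; tree theorem `serre_hasSurjectiveModNGaloisRep_pow_holds`), so the road's
class-level conclusion holds on every rank-one pair of cell (G-ord, `e = 2`) with `p ≥ 5` and `surj(p)` —
the census bit of the X4♯ ∩ surj rows — from PUBLISHED facts + the adjusted index bound `hL'` (STEP L′,
OPEN). At `p = 3` tower-surjectivity stays the hypothesis (Part 8). Nothing booked; the crux stays OPEN.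
[cite: SerreAbelianLadic1968, Ch. IV §3.4, Lemma 3 (IV-23)] [cite: JetchevSkinnerWan2017, §7.4.1 (pp. 29–31)]
[cite: Miller2011LMS, Def. 1.1] -/
theorem cellGordTwo_missingLowerBoundAt_rankOne_of_surj_five_of_adjustedIndexBound
    (hGZ : ∀ (N : ℕ) [NeZero N] (W : WeierstrassCurve ℚ) (K : Type) [Field K] [NumberField K],
      gross_zagier N W K)
    (hKo : ∀ (N : ℕ) [NeZero N] (W : WeierstrassCurve ℚ) (K : Type) [Field K] [NumberField K],
      kolyvagin N W K)
    (hKatoT : Kato2004.rankZero_padicValNat_sha_add_padicValNat_tamagawa_le_of_additive_potGood_of_imageContainsSL2)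
    (hGZK : rank_eq_analyticRank_of_analyticRank_le_one) (hmod : hasEntireLFunction_rat)
    (hnf : exists_isNewformOf) (hmodP : nonempty_modularParametrizationData)
    (hFH : friedbergHoffstein_exists_heegnerField_split_twist_ne_zero)
    (hL' : ∀ (W : WeierstrassCurve ℚ) [W.IsElliptic] [W.IsGloballyMinimal] (p : ℕ) [Fact p.Prime]
      (N : ℕ) [NeZero N] (K : Type) [Field K] [NumberField K]
      (Dt : ModularParametrizationData W N) (H : HeegnerDatum N (NumberField.discr K)) (ι : K →+* ℂ)
      (P : (W.baseChange K).toAffine.Point)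
      (Wd : WeierstrassCurve ℚ) [Wd.IsElliptic] [Wd.IsGloballyMinimal] (Cd : VariableChange ℚ),
      W.analyticRank = 1 → N10.CellGordTwo W p → (∀ n : ℕ, W.HasSurjectiveModNGaloisRep (p ^ n : ℕ)) →
      W.conductorNorm ℤ = N → IsImaginaryQuadratic K → SatisfiesHeegnerHypothesis N K →
      WeierstrassCurve.Affine.Point.map ι.toRatAlgHom P = heegnerPointComplex Dt H →
      Cd • W.quadraticTwist (NumberField.discr K : ℚ) = Wd →
      Finite (W.baseChange K).sha →
      (2 * padicValNat p (AddSubgroup.zmultiples P).index : ℤ) ≤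
        padicValNat p (W.baseChange K).shaOrder + padicValNat p W.tamagawaProduct +
          padicValNat p Wd.tamagawaProduct + 2 * padicValRat p (Dt.c : ℚ)) :
    ∀ (W : WeierstrassCurve ℚ) [W.IsElliptic] [W.IsGloballyMinimal] (p : ℕ) [Fact p.Prime],
      W.analyticRank = 1 → N10.CellGordTwo W p → 5 ≤ p → W.HasSurjectiveModNGaloisRep p →
      Typed.MissingLowerBoundAt W p := by
  intro W _ _ p _ hr hc2 hp5 hsurj
  exact cellGordTwo_missingLowerBoundAt_rankOne_of_towerSurj_of_adjustedIndexBound hGZ hKo hKatoT hGZK hmod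
    hnf hmodP hFH hL' W p hr hc2 (serre_hasSurjectiveModNGaloisRep_pow_holds W p hp5 hsurj)

/-- **The crux `GordTwoRankOne` BY NAME with the complement displayed on the census bits** — Part 8's
`gordTwoRankOne_of_adjustedIndexBound_of_rest` re-keyed: PUBLISHED binders + STEP L′ (`hL'`) on the
rows that are tower-surjective (at `p ≥ 5` this is just `surj(p)`, Serre), Li–Liu–Tian 2024 on the CM rows
(`hLLT`, lane A's `gordTwoRankOne_cm_of_liLiuTian`), and the crux DISPLAYED on exactly: `hRest5` — the
non-CM rows with `p ≥ 5` and `ρ̄_{E,p}` NOT onto (X3♯ reducible rows, O8 small-image rows); `hRest3` —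
the non-CM rows at `p = 3` that are not tower-surjective (X3♯ at 3, 3-adic image defects incl. Elkies'
9-deficient surj(3) rows). An honest split, not a closure; nothing booked; the item stays OPEN.
[cite: SerreAbelianLadic1968, Ch. IV §3.4, Lemma 3 (IV-23)] [cite: JetchevSkinnerWan2017, §7.4.1 (pp. 29–31)]
[cite: LiLiuTian2024, Thm. 1.1 (i)] [cite: Miller2011LMS, Def. 1.1] -/
theorem gordTwoRankOne_of_adjustedIndexBound_of_rest'
    (hGZ : ∀ (N : ℕ) [NeZero N] (W : WeierstrassCurve ℚ) (K : Type) [Field K] [NumberField K],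
      gross_zagier N W K)
    (hKo : ∀ (N : ℕ) [NeZero N] (W : WeierstrassCurve ℚ) (K : Type) [Field K] [NumberField K],
      kolyvagin N W K)
    (hKatoT : Kato2004.rankZero_padicValNat_sha_add_padicValNat_tamagawa_le_of_additive_potGood_of_imageContainsSL2)
    (hGZK : rank_eq_analyticRank_of_analyticRank_le_one) (hmod : hasEntireLFunction_rat)
    (hnf : exists_isNewformOf) (hmodP : nonempty_modularParametrizationData)
    (hFH : friedbergHoffstein_exists_heegnerField_split_twist_ne_zero)
    (hLLT : LiLiuTian2024.thm11_bsdp_of_cm_rank_one)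
    (hL' : ∀ (W : WeierstrassCurve ℚ) [W.IsElliptic] [W.IsGloballyMinimal] (p : ℕ) [Fact p.Prime]
      (N : ℕ) [NeZero N] (K : Type) [Field K] [NumberField K]
      (Dt : ModularParametrizationData W N) (H : HeegnerDatum N (NumberField.discr K)) (ι : K →+* ℂ)
      (P : (W.baseChange K).toAffine.Point)
      (Wd : WeierstrassCurve ℚ) [Wd.IsElliptic] [Wd.IsGloballyMinimal] (Cd : VariableChange ℚ),
      W.analyticRank = 1 → N10.CellGordTwo W p → (∀ n : ℕ, W.HasSurjectiveModNGaloisRep (p ^ n : ℕ)) →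
      W.conductorNorm ℤ = N → IsImaginaryQuadratic K → SatisfiesHeegnerHypothesis N K →
      WeierstrassCurve.Affine.Point.map ι.toRatAlgHom P = heegnerPointComplex Dt H →
      Cd • W.quadraticTwist (NumberField.discr K : ℚ) = Wd →
      Finite (W.baseChange K).sha →
      (2 * padicValNat p (AddSubgroup.zmultiples P).index : ℤ) ≤
        padicValNat p (W.baseChange K).shaOrder + padicValNat p W.tamagawaProduct +
          padicValNat p Wd.tamagawaProduct + 2 * padicValRat p (Dt.c : ℚ))
    (hRest5 : ∀ (W : WeierstrassCurve ℚ) [W.IsElliptic] [W.IsGloballyMinimal] (p : ℕ) [Fact p.Prime],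
      W.analyticRank = 1 → N10.CellGordTwo W p → 5 ≤ p → ¬ W.HasCM →
      ¬ W.HasSurjectiveModNGaloisRep p → Typed.MissingLowerBoundAt W p)
    (hRest3 : ∀ (W : WeierstrassCurve ℚ) [W.IsElliptic] [W.IsGloballyMinimal] (p : ℕ) [Fact p.Prime],
      W.analyticRank = 1 → N10.CellGordTwo W p → p = 3 → ¬ W.HasCM →
      ¬ (∀ n : ℕ, W.HasSurjectiveModNGaloisRep (p ^ n : ℕ)) → Typed.MissingLowerBoundAt W p) :
    Summit.BirchSwinnertonDyer.BirchSwinnertonDyer.Theses.AdditiveBranchIMC.GordTwoRankOne := by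
  intro W _ _ p _ hr hc2
  have hp : p.Prime := Fact.out
  by_cases hcm : W.HasCM
  · exact gordTwoRankOne_cm_of_liLiuTian hLLT W p hr hc2 hcm
  by_cases htower : ∀ n : ℕ, W.HasSurjectiveModNGaloisRep (p ^ n : ℕ)
  · exact cellGordTwo_missingLowerBoundAt_rankOne_of_towerSurj_of_adjustedIndexBound hGZ hKo hKatoT hGZK
      hmod hnf hmodP hFH hL' W p hr hc2 htower
  by_cases hp5 : 5 ≤ p
  · have hns : ¬ W.HasSurjectiveModNGaloisRep p := fun hs ↦
      htower (serre_hasSurjectiveModNGaloisRep_pow_holds W p hp5 hs)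
    exact hRest5 W p hr hc2 hp5 hcm hns
  · have hp2 : p ≠ 2 := hc2.1
    have h2 : 2 ≤ p := hp.two_le
    have hlt : p < 5 := not_le.mp hp5
    have hp3 : p = 3 := by
      interval_cases p
      · exact absurd rfl hp2
      · rfl
      · exact absurd hp (by norm_num)
    exact hRest3 W p hr hc2 hp3 hcm htower

end Summit.BirchSwinnertonDyer.BirchSwinnertonDyer.Theorems.AdditiveBranchIMCGordTwoRankOne.HeegnerKolyvagin

end
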